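import Summits.QuantumAdvantage.QuantumAdvantage.Theorems.CertDialH
import HarnessLib

/-!
# CertDial — part I (§11): THE OR-ANTIPODE BEATS WEIGHT THREE AT THE OTHER RESIDUE

Part H showed that for `n ≡ 2 (mod 4)` the affine strategy `x_{b+1} ⊕ x_{b+n/2}` wins every odd-class input of
weight `≤ 3`.  For `n ≡ 0 (mod 4)` the antipodal offset `n/2` is even and the XOR rule breaks; the repair is the
QUADRATIC rule `z_b = x_{b+1} ∨ x_{b+n/2+1}` — over `𝔽₃` the polynomial `X_s + X_t + 2·X_s X_t` of degree `2` —
whose two read offsets `1` and `n/2 + 1` are again both odd.  We prove it wins every odd-class input of weight `≤ 3`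
(`orAnti_perfect_three`, inclusion–exclusion: the overlap term counts antipodal pairs inside the input, an even
number), that it is not parity-local, and conclude the residue-free form of §10: EVERY even length `n ≥ 12`
carries a generic strategy of degree `≤ 2` that is perfect to weight three (`generic_perfect_three`,
`weightThree_leaf_fails_everywhere`).  Numerically (g28 `num/covaffine.py`) no AFFINE covariant junta of size `≤ 3` on the
near/antipodal offsets is perfect to weight 3 when `n ≡ 0 (mod 4)`: at that residue degree 2 seems needed.
READING for the lineage: nothing here touches the weight-7 leaves `PGlobalFail 2 2 7` / `OGlobalFail 2 2 7` or 27432; with part H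
it pins the dial — weight 3 is won by generic quadratic strategies at EVERY even length, so the generic leaf lives at weight `≥ 5`.
`lean check` on the tree closure: rc 0, no warnings, no placeholders; axioms standard (`propext`, `Classical.choice`, `Quot.sound`).
-/

set_option linter.dupNamespace false
set_option linter.style.longLine false

noncomputable section
open scoped Classical

namespace Summit.QuantumAdvantage.QuantumAdvantage.Theorems.CertDial
open Finset
open Literature.Computability.QuantumComplexity Literature.Computability.QuantumComplexity.RingHLF
open Summit.QuantumAdvantage.AdviceFreeQNC0
open Literature.Computability.MetaComplexity Literature.Computability.MetaComplexity.Smolensky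
open Summit.QuantumAdvantage.QuantumAdvantage.Theorems.LightDial (wt ind onesOf ind_onesOf wt_eq_card_onesOf oddZeros_ind_iff
  mono_singleton_apply)
open Summit.QuantumAdvantage.QuantumAdvantage.Theorems.ParityDial (par offs IsParityLocal PGlobalFail)
open Summit.QuantumAdvantage.AdviceFreeQNC0.LightConeWindowHard (window window_apply)
open Summit.QuantumAdvantage.AdviceFreeQNC0.RingSymmetry (shift rot_apply rel_rot card_filter_shift shift_shift)

variable {n : ℕ}

/-! ### §11a Inclusion–exclusion and the antipodal-pair count -/

/-- inclusion–exclusion for an OR count. -/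
theorem card_or_add (E : Fin n → Prop) [DecidablePred E] (u v : Fin n → Bool) :
    (univ.filter fun b : Fin n => E b ∧ (u b || v b) = true).card + (univ.filter fun b : Fin n => E b ∧ (u b && v b) = true).card =
      (univ.filter fun b : Fin n => E b ∧ u b = true).card + (univ.filter fun b : Fin n => E b ∧ v b = true).card := by
  have h : ∀ b : Fin n, ((if E b ∧ (u b || v b) = true then 1 else 0) + (if E b ∧ (u b && v b) = true then 1 else 0) : ℕ) =
      (if E b ∧ u b = true then 1 else 0) + (if E b ∧ v b = true then 1 else 0) := by
    intro b
    by_cases hE : E b <;> cases hu : u b <;> cases hv : v b <;> simp [hE]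
  have hs := Finset.sum_congr rfl fun b (_ : b ∈ (univ : Finset (Fin n))) => h b
  rw [Finset.sum_add_distrib, Finset.sum_add_distrib, ← Finset.card_filter, ← Finset.card_filter, ← Finset.card_filter,
    ← Finset.card_filter] at hs
  exact hs

/-- … so the parity of an OR count is that of the two counts plus the overlap. -/
theorem card_or_mod_two (E : Fin n → Prop) [DecidablePred E] (u v : Fin n → Bool) :
    (univ.filter fun b : Fin n => E b ∧ (u b || v b) = true).card % 2 =
      ((univ.filter fun b : Fin n => E b ∧ u b = true).card + (univ.filter fun b : Fin n => E b ∧ v b = true).card +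
        (univ.filter fun b : Fin n => E b ∧ (u b && v b) = true).card) % 2 := by
  have h := card_or_add E u v
  omega

/-- shifting twice by `n/2` is the identity (even `n`). -/
theorem shift_half_half (he : n % 2 = 0) (c : Fin n) : shift n (n / 2) (shift n (n / 2) c) = c := by
  have h := shift_sub_shift (k := n / 2) (n := n) (by omega) c
  rwa [show n - n / 2 = n / 2 by omega] at h

/-- the number of positions `c` with `x_c = x_{c+n/2} = 1` is EVEN: the antipodal involution swaps the two halves of that set. -/
theorem card_antipodal_pairs_even (he : n % 2 = 0) (x : Fin n → Bool) :
    (univ.filter fun c : Fin n => x c = true ∧ x (shift n (n / 2) c) = true).card % 2 = 0 := by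
  set Q : Fin n → Prop := fun c => (x c = true ∧ x (shift n (n / 2) c) = true) ∧ (c : ℕ) < n / 2 with hQ
  have hsplit := Finset.card_filter_add_card_filter_not (s := univ.filter fun c : Fin n => x c = true ∧ x (shift n (n / 2) c) = true)
    (fun c : Fin n => (c : ℕ) < n / 2)
  rw [Finset.filter_filter, Finset.filter_filter] at hsplit
  have hswap : (univ.filter fun c : Fin n => (x c = true ∧ x (shift n (n / 2) c) = true) ∧ ¬ (c : ℕ) < n / 2).card =
      (univ.filter fun c : Fin n => Q c).card := by
    rw [← card_filter_shift (n / 2) (fun c : Fin n => Q c)]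
    refine congrArg Finset.card (Finset.filter_congr fun c _ => ?_)
    have hc := c.isLt
    simp only [hQ, shift_half_half he, val_shift]
    constructor
    · rintro ⟨⟨h1, h2⟩, h3⟩
      refine ⟨⟨h2, h1⟩, ?_⟩
      rw [show (c : ℕ) + n / 2 = ((c : ℕ) - n / 2) + n by omega, Nat.add_mod_right, Nat.mod_eq_of_lt (by omega)]; omega
    · rintro ⟨⟨h1, h2⟩, h3⟩
      refine ⟨⟨h2, h1⟩, fun h4 => ?_⟩
      rw [Nat.mod_eq_of_lt (by omega)] at h3; omega
  rw [hswap] at hsplit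
  simp only [hQ] at hsplit
  omega

/-! ### §11b The OR-antipode strategy -/

/-- ★ the OR-ANTIPODE strategy `P_b = X_s + X_t + 2·X_s X_t` (`s = b+1`, `t = b+n/2+1`) over `𝔽₃`: answer `1` iff `x_s ∨ x_t`. -/
def orAnti (n : ℕ) : Fin n → CubeFn (ZMod 3) n := fun b =>
  mono (ZMod 3) ({shift n 1 b} : Finset (Fin n)) + mono (ZMod 3) ({shift n (1 + n / 2) b} : Finset (Fin n)) +
    (2 : ZMod 3) • mono (ZMod 3) ({shift n 1 b, shift n (1 + n / 2) b} : Finset (Fin n))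

/-- it has degree `≤ 2`. -/
theorem orAnti_mem (b : Fin n) : orAnti n b ∈ lowDeg (ZMod 3) n 2 := by
  refine Submodule.add_mem _ (Submodule.add_mem _ (mono_mem_lowDeg (by simp)) (mono_mem_lowDeg (by simp)))
    (Submodule.smul_mem _ (2 : ZMod 3) (mono_mem_lowDeg Finset.card_le_two))

/-- its answer bit is the OR of the two read bits. -/
theorem orAnti_eq_one_iff (b : Fin n) (x : Fin n → Bool) :
    orAnti n b x = 1 ↔ (x (shift n 1 b) || x (shift n (1 + n / 2) b)) = true := by
  simp only [orAnti, Pi.add_apply, Pi.smul_apply, smul_eq_mul, mono_apply, Finset.mem_insert, Finset.mem_singleton,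
    forall_eq_or_imp, forall_eq]
  cases x (shift n 1 b) <;> cases x (shift n (1 + n / 2) b) <;> decide

/-- its answer map. -/
theorem ans_orAnti (x : Fin n → Bool) : ans (orAnti n) x = fun b => x (shift n 1 b) || x (shift n (1 + n / 2) b) := by
  funext b
  unfold ans
  rw [Bool.eq_iff_iff, decide_eq_true_eq]
  exact orAnti_eq_one_iff b x

/-- it is rotation-EQUIVARIANT. -/
theorem orAnti_equivariant (k : ℕ) (x : Fin n → Bool) : ans (orAnti n) (rot k x) = rot k (ans (orAnti n) x) := by
  rw [ans_orAnti, ans_orAnti]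
  funext b
  simp only [rot_apply, shift_shift]
  rw [Nat.add_comm k 1, Nat.add_comm k (1 + n / 2)]

/-- the overlap count of the two reads, re-indexed: it counts antipodal pairs inside the input (intersected with a condition). -/
theorem card_and_reads (E : Fin n → Prop) [DecidablePred E] (x : Fin n → Bool) (hn : 1 ≤ n) :
    (univ.filter fun b : Fin n => E b ∧ (x (shift n 1 b) && x (shift n (1 + n / 2) b)) = true).card =
      (univ.filter fun c : Fin n => E (shift n (n - 1) c) ∧ (x c && x (shift n (n / 2) c)) = true).card := by
  rw [← card_filter_and_shift E (fun c : Fin n => x c && x (shift n (n / 2) c)) hn]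
  exact congrArg Finset.card (Finset.filter_congr fun b _ => by rw [shift_shift])

/-! ### §11c It wins every light input when `n ≡ 0 (mod 4)` -/

/-- MONOCHROMATIC odd-class inputs (any weight) are won when `n ≡ 0 (mod 4)`: both read offsets `1`, `n/2 + 1` are odd, and the overlap
term of inclusion–exclusion is the even antipodal-pair count. -/
theorem orAnti_wins_mono (h4 : n % 4 = 0) (hn : 3 ≤ n) {x : Fin n → Bool} (hx : OddZeros x) {q : Bool}
    (hq : ∀ b, x b = true → par b = q) : Rel x (ans (orAnti n) x) := by
  have he : n % 2 = 0 := by omega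
  rw [rel_mono_iff he hn hx hq, ans_orAnti, card_or_mod_two (fun b : Fin n => par b ≠ q),
    card_filter_and_shift _ _ (show 1 ≤ n by omega), card_filter_and_shift _ _ (show 1 + n / 2 ≤ n by omega),
    card_and_reads _ _ (show 1 ≤ n by omega)]
  have hA : ∀ {k : ℕ}, k % 2 = 1 →
      (univ.filter fun c : Fin n => par (shift n k c) ≠ q ∧ x c = true).card = (univ.filter fun c : Fin n => x c = true).card := by
    intro k hk
    exact congrArg Finset.card (Finset.filter_congr fun c _ =>
      ⟨fun h => h.2, fun h => ⟨by rw [← hq c h]; exact par_shift_ne he hk c, h⟩⟩)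
  have hB : (univ.filter fun c : Fin n => par (shift n (n - 1) c) ≠ q ∧ (x c && x (shift n (n / 2) c)) = true).card =
      (univ.filter fun c : Fin n => x c = true ∧ x (shift n (n / 2) c) = true).card := by
    refine congrArg Finset.card (Finset.filter_congr fun c _ => ?_)
    rw [Bool.and_eq_true]
    exact ⟨fun h => h.2, fun h => ⟨by rw [← hq c h.1]; exact par_shift_ne he (show (n - 1) % 2 = 1 by omega) c, h⟩⟩
  rw [hA (show (n - 1) % 2 = 1 by omega), hA (show (n - (1 + n / 2)) % 2 = 1 by omega), hB]
  have hev := card_antipodal_pairs_even he x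
  omega

/-- the overlap count on the two-one input, position by position. -/
theorem card_overlap_tri (E : Fin n → Prop) [DecidablePred E] {d e : ℕ} (hd : 0 < d) (hde : d < e) (hen : e < n) :
    (univ.filter fun b : Fin n => E b ∧ (tri n d e (shift n 1 b) && tri n d e (shift n (1 + n / 2) b)) = true).card =
      (if E (shift n (n - 1) ⟨0, by omega⟩) ∧ tri n d e (shift n (n / 2) ⟨0, by omega⟩) = true then 1 else 0) +
      (if E (shift n (n - 1) ⟨d, by omega⟩) ∧ tri n d e (shift n (n / 2) ⟨d, by omega⟩) = true then 1 else 0) +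
      (if E (shift n (n - 1) ⟨e, hen⟩) ∧ tri n d e (shift n (n / 2) ⟨e, hen⟩) = true then 1 else 0) := by
  rw [card_and_reads _ _ (show 1 ≤ n by omega),
    ← card_filter_and_tri (fun c : Fin n => E (shift n (n - 1) c) ∧ tri n d e (shift n (n / 2) c) = true) hd hde hen]
  refine congrArg Finset.card (Finset.filter_congr fun c _ => ?_)
  rw [Bool.and_eq_true]
  exact ⟨fun h => ⟨⟨h.1, h.2.2⟩, h.2.1⟩, fun h => ⟨h.1.1, h.2, h.1.2⟩⟩

/-- the normalised TWO-ONE input `1_{0,d,e}` (`d` even, `e` odd, `2 ≤ d < e < n`) is won when `n ≡ 0 (mod 4)`: with `h = n/2` the read-backs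
of the first read land in the electorate `E ∪ [0,d)` at `d − 1`, `e − 1`; those of the second at `e + h − 1` always, at `h − 1` iff `h ≤ d`
and at `d − h − 1` iff `h < d`; the overlap contributes exactly when `d = h` — parities `2 + 3 + 0`, `2 + 2 + 1`, `2 + 1 + 0`, all odd. -/
theorem orAnti_wins_tri (h4 : n % 4 = 0) {d e : ℕ} (hd2 : d % 2 = 0) (he2 : e % 2 = 1) (hd : 2 ≤ d) (hde : d < e) (hen : e < n) :
    Rel (tri n d e) (ans (orAnti n) (tri n d e)) := by
  have he : n % 2 = 0 := by omega
  have hn : 3 ≤ n := by omega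
  rw [rel_tri_iff he hn hd2 he2 hd hde hen, ans_orAnti, card_or_mod_two (fun b : Fin n => (b : ℕ) % 2 = 0 ∨ (b : ℕ) < d),
    card_filter_and_shift _ _ (show 1 ≤ n by omega), card_filter_and_shift _ _ (show 1 + n / 2 ≤ n by omega),
    card_filter_and_tri _ (by omega) hde hen, card_filter_and_tri _ (by omega) hde hen, card_overlap_tri _ (by omega) hde hen]
  simp only [val_shift, tri, decide_eq_true_eq]
  -- the read-back positions, as plain numbers
  have e1 : (0 + (n - 1)) % n = n - 1 := by rw [Nat.zero_add]; exact Nat.mod_eq_of_lt (by omega)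
  have e2 : (d + (n - 1)) % n = d - 1 := by rw [show d + (n - 1) = (d - 1) + n by omega, Nat.add_mod_right, Nat.mod_eq_of_lt (by omega)]
  have e3 : (e + (n - 1)) % n = e - 1 := by rw [show e + (n - 1) = (e - 1) + n by omega, Nat.add_mod_right, Nat.mod_eq_of_lt (by omega)]
  have e4 : (0 + (n - (1 + n / 2))) % n = n / 2 - 1 := by
    rw [show 0 + (n - (1 + n / 2)) = n / 2 - 1 by omega]; exact Nat.mod_eq_of_lt (by omega)
  have e6p : ((e + (n - (1 + n / 2))) % n) % 2 = 0 := by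
    rw [Nat.mod_mod_of_dvd _ (Nat.dvd_of_mod_eq_zero he)]; omega
  have e7 : (0 + n / 2) % n = n / 2 := by rw [Nat.zero_add]; exact Nat.mod_eq_of_lt (by omega)
  have e9 : ¬ ((e + n / 2) % n = 0 ∨ (e + n / 2) % n = d ∨ (e + n / 2) % n = e) := by
    have : ((e + n / 2) % n) % 2 = 1 := by rw [Nat.mod_mod_of_dvd _ (Nat.dvd_of_mod_eq_zero he)]; omega
    by_cases hw : e + n / 2 < n
    · rw [Nat.mod_eq_of_lt hw]; omega
    · rw [show e + n / 2 = (e + n / 2 - n) + n by omega, Nat.add_mod_right, Nat.mod_eq_of_lt (by omega)]; omega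
  have f1 : ¬ ((n - 1) % 2 = 0 ∨ n - 1 < d) := by omega
  have f2 : (d - 1) % 2 = 0 ∨ d - 1 < d := Or.inr (by omega)
  have f3 : (e - 1) % 2 = 0 ∨ e - 1 < d := Or.inl (by omega)
  have f6 : (e + (n - (1 + n / 2))) % n % 2 = 0 ∨ (e + (n - (1 + n / 2))) % n < d := Or.inl e6p
  rcases Nat.lt_trichotomy (n / 2) d with hlt | heq | hgt
  · -- `h < d`
    have e5 : (d + (n - (1 + n / 2))) % n = d - n / 2 - 1 := by
      rw [show d + (n - (1 + n / 2)) = (d - n / 2 - 1) + n by omega, Nat.add_mod_right, Nat.mod_eq_of_lt (by omega)]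
    have e8 : (d + n / 2) % n = d - n / 2 := by
      rw [show d + n / 2 = (d - n / 2) + n by omega, Nat.add_mod_right, Nat.mod_eq_of_lt (by omega)]
    have f4 : (n / 2 - 1) % 2 = 0 ∨ n / 2 - 1 < d := Or.inr (by omega)
    have f5 : (d - n / 2 - 1) % 2 = 0 ∨ d - n / 2 - 1 < d := Or.inr (by omega)
    have g8 : ¬ (d - n / 2 = 0 ∨ d - n / 2 = d ∨ d - n / 2 = e) := by omega
    simp only [e1, e2, e3, e4, e5, e7, e8, e9, f1, f2, f3, f4, f5, f6, g8, if_true, if_false, false_and, and_false]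
  · -- `h = d`
    have e5 : (d + (n - (1 + n / 2))) % n = n - 1 := by
      rw [show d + (n - (1 + n / 2)) = n - 1 by omega]; exact Nat.mod_eq_of_lt (by omega)
    have e8 : (d + n / 2) % n = 0 := by rw [show d + n / 2 = n by omega, Nat.mod_self]
    have f4 : (n / 2 - 1) % 2 = 0 ∨ n / 2 - 1 < d := Or.inr (by omega)
    have g7 : n / 2 = 0 ∨ n / 2 = d ∨ n / 2 = e := Or.inr (Or.inl heq)
    simp only [e1, e2, e3, e4, e5, e7, e8, e9, f1, f2, f3, f4, f6, g7, true_or, if_true, if_false, and_false, and_true]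
  · -- `d < h`
    have e5 : (d + (n - (1 + n / 2))) % n = d + n / 2 - 1 := by
      rw [show d + (n - (1 + n / 2)) = d + n / 2 - 1 by omega]; exact Nat.mod_eq_of_lt (by omega)
    have e8 : (d + n / 2) % n = d + n / 2 := Nat.mod_eq_of_lt (by omega)
    have f4 : ¬ ((n / 2 - 1) % 2 = 0 ∨ n / 2 - 1 < d) := by omega
    have f5 : ¬ ((d + n / 2 - 1) % 2 = 0 ∨ d + n / 2 - 1 < d) := by omega
    have g7' : ¬ (n / 2 = 0 ∨ n / 2 = d ∨ n / 2 = e) := by omega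
    have g8 : ¬ (d + n / 2 = 0 ∨ d + n / 2 = d ∨ d + n / 2 = e) := by omega
    simp only [e1, e2, e3, e4, e5, e7, e8, e9, f1, f2, f3, f4, f5, f6, g7', g8, if_true, if_false, and_false]

/-- … hence every two-one input in general position (rotation equivariance). -/
theorem orAnti_wins_triAt (h4 : n % 4 = 0) (i : Fin n) {d e : ℕ} (hd2 : d % 2 = 0) (he2 : e % 2 = 1) (hd : 2 ≤ d) (hde : d < e)
    (hen : e < n) : Rel (triAt i d e) (ans (orAnti n) (triAt i d e)) := by
  rw [triAt_eq_rot, orAnti_equivariant, rel_rot]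
  exact orAnti_wins_tri h4 hd2 he2 hd hde hen

/-- ★★★ THE OR-ANTIPODE BEATS WEIGHT THREE: for `n ≡ 0 (mod 4)`, `n ≥ 4`, the quadratic OR-antipode strategy wins EVERY odd-class input of
weight `≤ 3`. -/
theorem orAnti_perfect_three (h4 : n % 4 = 0) (hn : 4 ≤ n) {x : Fin n → Bool} (hx : OddZeros x) (hw : LightDial.wt x ≤ 3) :
    Rel x (ans (orAnti n) x) := by
  rcases light_three_cases (by omega) hx hw with ⟨q, hq⟩ | ⟨i, d, e, hd2, he2, hd, hde, hen, rfl⟩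
  · exact orAnti_wins_mono h4 (by omega) hx hq
  · exact orAnti_wins_triAt h4 i hd2 he2 hd hde hen

/-! ### §11d It is generic; weight three is beaten at every even length -/

/-- `orAnti` is NOT parity-local of radius `2` (`n ≡ 0 (mod 4)`, `n ≥ 12`): on the input `e_{n/2+1}` positions `0` and `2` see the same
(empty) window but answer differently. -/
theorem orAnti_not_parityLocal (h4 : n % 4 = 0) (hn : 12 ≤ n) : ¬ IsParityLocal 2 (orAnti n) := by
  intro hP
  have h0 : 0 < n := by omega
  have h2 : 2 < n := by omega
  have hw : window 2 (lightPt n (1 + n / 2)) ⟨0, h0⟩ = window 2 (lightPt n (1 + n / 2)) ⟨2, h2⟩ := by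
    funext d
    have hd := d.isLt
    rw [window_apply 2 (by omega), window_apply 2 (by omega)]
    simp only [lightPt, decide_eq_decide]
    split_ifs <;> omega
  have x1 : lightPt n (1 + n / 2) (shift n 1 ⟨0, h0⟩) = false := by
    simp only [lightPt, val_shift]; exact decide_eq_false (by rw [Nat.mod_eq_of_lt (by omega)]; omega)
  have x2 : lightPt n (1 + n / 2) (shift n (1 + n / 2) ⟨0, h0⟩) = true := by
    simp only [lightPt, val_shift]; exact decide_eq_true (by rw [Nat.mod_eq_of_lt (by omega)]; omega)
  have x3 : lightPt n (1 + n / 2) (shift n 1 ⟨2, h2⟩) = false := by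
    simp only [lightPt, val_shift]; exact decide_eq_false (by rw [Nat.mod_eq_of_lt (by omega)]; omega)
  have x4 : lightPt n (1 + n / 2) (shift n (1 + n / 2) ⟨2, h2⟩) = false := by
    simp only [lightPt, val_shift]; exact decide_eq_false (by rw [Nat.mod_eq_of_lt (by omega)]; omega)
  have key := (hP (lightPt n (1 + n / 2)) ⟨0, h0⟩ ⟨2, h2⟩ (by simp [par]) hw).1
  rw [orAnti_eq_one_iff, orAnti_eq_one_iff, x1, x2, x3, x4] at key
  exact Bool.false_ne_true (key rfl)

/-- ★★★ WEIGHT THREE IS BEATEN AT EVERY EVEN LENGTH `n ≥ 12` by a generic (non-parity-local) strategy of degree `≤ 2`: `xorAnti` (affine) when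
`n ≡ 2 (mod 4)` (part H), `orAnti` (quadratic) when `n ≡ 0 (mod 4)`. -/
theorem generic_perfect_three (he : n % 2 = 0) (hn : 12 ≤ n) :
    ∃ P : Fin n → CubeFn (ZMod 3) n, (∀ i, P i ∈ lowDeg (ZMod 3) n 2) ∧ ¬ IsParityLocal 2 P ∧
      ∀ x : Fin n → Bool, OddZeros x → LightDial.wt x ≤ 3 → Rel x (ans P x) := by
  by_cases h4 : n % 4 = 0
  · exact ⟨orAnti n, orAnti_mem, orAnti_not_parityLocal h4 hn, fun x hx hw => orAnti_perfect_three h4 (by omega) hx hw⟩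
  · have h4' : n % 4 = 2 := by omega
    exact ⟨xorAnti n, fun i => lowDeg_mono (by norm_num) (xorAnti_mem i), xorAnti_not_parityLocal h4' (by omega),
      fun x hx hw => xorAnti_perfect_three h4' (by omega) hx hw⟩

/-- … in the exact shape of the leaf `ParityDial.PGlobalFail 2 D 3` at ONE length: its per-length clause fails at every even `n ≥ 12` for every
degree bound `D ≥ 2` (part H gave the failure along `n ≡ 2 (mod 4)` for `D ≥ 1`; for `D = 1` at `n ≡ 0 (mod 4)` it is open — numerically no
affine covariant junta of size `≤ 3` on the near/antipodal offsets is perfect to weight 3 there). -/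
theorem weightThree_leaf_fails_everywhere (he : n % 2 = 0) (hn : 12 ≤ n) {D : ℕ} (hD : 2 ≤ D) :
    ¬ (∀ P : Fin n → CubeFn (ZMod 3) n, (∀ i, P i ∈ lowDeg (ZMod 3) n D) → ¬ IsParityLocal 2 P →
        ∃ x : Fin n → Bool, OddZeros x ∧ LightDial.wt x ≤ 3 ∧ ¬ Rel x (fun i => decide (P i x = 1))) := by
  intro h
  obtain ⟨P, hP, hgen, hwin⟩ := generic_perfect_three he hn
  obtain ⟨x, hx, hw, hrel⟩ := h P (fun i => lowDeg_mono hD (hP i)) hgen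
  exact hrel (hwin x hx hw)

/-! ### Axiom audit -/

/-- info: 'Summit.QuantumAdvantage.QuantumAdvantage.Theorems.CertDial.orAnti_perfect_three' depends on axioms: [propext,
 Classical.choice,
 Quot.sound] -/
#guard_msgs in #print axioms orAnti_perfect_three

/-- info: 'Summit.QuantumAdvantage.QuantumAdvantage.Theorems.CertDial.generic_perfect_three' depends on axioms: [propext,
 Classical.choice,
 Quot.sound] -/
#guard_msgs in #print axioms generic_perfect_three

/-- info: 'Summit.QuantumAdvantage.QuantumAdvantage.Theorems.CertDial.weightThree_leaf_fails_everywhere' depends on axioms: [propext,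
 Classical.choice,
 Quot.sound] -/
#guard_msgs in #print axioms weightThree_leaf_fails_everywhere

end Summit.QuantumAdvantage.QuantumAdvantage.Theorems.CertDial

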